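import Mathlib
import HarnessLib
import Summits.Ventures.LatticeQCDFlow.Exactness.SUNMetropolisKickLaw
import Summits.Ventures.LatticeQCDFlow.Exactness.MetropolisSweepConvergence

/-!
# The engine's `SU(N)` Metropolis sweep converges to the Wilson measure from every start AT EVERY TIME

HONEST FRAMING: exact (Metropolis-corrected) sampling algorithms for lattice gauge theory;
figures of merit are autocorrelation/cost numbers at stated couplings and volumes; no
continuum-physics claim.

Venture `LatticeQCDFlow` (cell pub-lqcd), topic `Exactness`, FANOUT row 9 (eng-latcore, the
engine `latflow.core.updates.sweep_metropolis` (4D) / `sun_2d.sweep_metropolis` (2D), every `N`).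
NEW WORK of the cell over the tree (`SUNMetropolisKickLaw.lean`: the engine's `SU(N)` kicks cover;
`MetropolisSweepConvergence.lean`: a covering step law gives convergence at every time, rate
`(1 − ε)^{⌊r/(k+1)⌋}`); nothing is cited as a fact.  The `SU(N)` line of the table whose `U(1)` and
`SU(2)` lines are `wilson_u1MetropolisSweep_converges` / `wilson_su2MetropolisSweep_converges`.

* **`wilson_sunMetropolisSweep_converges`** — for every `N ≥ 1`, kick size `s > 0`, `nhit = n ≥ 1`,
  scan `Ls` through all edges of the torus `(ℤ/L)^d`, continuous representation `ρ` and every `β`: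
  there are `t ≥ 1` and `ε ∈ (0, 1]` with
  `|μ₀ Sʳ(A) − wilsonMeasure ρ β (A)| ≤ (1 − ε)^{⌊r/t⌋}` for EVERY initial law `μ₀`, every `r`, every
  `A`, `S = metropolisSweep (sunMetropolisKick N s) e^{−βS_W} n Ls` the engine's sweep.

NOT CLAIMED: any value of `t` or `ε`; floating point.
-/

noncomputable section

namespace Summit.Ventures.LatticeQCDFlow.Exactness

open MeasureTheory ProbabilityTheory Set Function
open Literature.MathematicalPhysics.QuantumFieldTheory
open scoped ENNReal

variable (N : ℕ) [NeZero N] (s : ℝ) [Fact (0 < s)] {d L M : ℕ}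
  (ρ : Matrix.specialUnitaryGroup (Fin N) ℂ →* Matrix (Fin M) (Fin M) ℂ)

/-- **THE ENGINE'S `SU(N)` METROPOLIS SWEEP CONVERGES TO THE WILSON MEASURE FROM EVERY START AT EVERY
TIME**: `|μ₀ Sʳ(A) − wilsonMeasure(A)| ≤ (1 − ε)^{⌊r/t⌋}` with `t ≥ 1`, `ε ∈ (0, 1]` depending only on
`N, s, n, Ls, ρ, β`. -/
theorem wilson_sunMetropolisSweep_converges [NeZero L] (hρ : Continuous ρ) (β : ℝ) {n : ℕ} (hn : 1 ≤ n)
    {Ls : List (Edge d L)} (hLs : ∀ e, e ∈ Ls) :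
    ∃ t : ℕ, 1 ≤ t ∧ ∃ ε : ℝ, 0 < ε ∧ ε ≤ 1 ∧
      ∀ (μ₀ : Measure (GaugeConfig d L (Matrix.specialUnitaryGroup (Fin N) ℂ))) [IsProbabilityMeasure μ₀]
        (r : ℕ) (A : Set (GaugeConfig d L (Matrix.specialUnitaryGroup (Fin N) ℂ))),
        |((fun m' : Measure (GaugeConfig d L (Matrix.specialUnitaryGroup (Fin N) ℂ)) =>
              m'.bind (metropolisSweep (sunMetropolisKick N s)
                (fun U : GaugeConfig d L (Matrix.specialUnitaryGroup (Fin N) ℂ) =>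
                  Real.exp (-β * wilsonAction ρ U)) n Ls))^[r] μ₀).real A
            - (wilsonMeasure (d := d) (L := L) ρ β).real A| ≤ (1 - ε) ^ (r / t) := by
  obtain ⟨k, δ, hδ, hcov⟩ := exists_sunMetropolisKick_cover N s
  obtain ⟨ε, hε0, hε1, h⟩ := wilson_metropolisSweep_converges (d := d) (L := L) ρ hρ β hcov hδ hn hLs
  exact ⟨k + 1, Nat.succ_pos k, ε, hε0, hε1, h⟩

end Summit.Ventures.LatticeQCDFlow.Exactness
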